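import Summits.CriticalPhenomena.PercolationContinuityZ3.Theorems.PercNearOneGluingNoHeavyQuantTwoPointHubSliver
import HarnessLib

/-!
# QUANT lane R8, blob lemma (U): raising one gate, gate monotonicity, the half-world row, and (U) with a single sub-half gate

builds on p205010 (kernel theorem, internal audit signed; external expert review pending)

Support file (`--supports stmt-CriticalPhenomena-4575`), QUANT lane seat prim-quant-census-1 (gen 12); memo
`run/shared/lean/prim/quant/prim-quant-census-1/U-REDUCTIONS-G12.md` §1–§3.  Theorems only; no sorries; standard axioms.

Setting of `…QuantTwoPointHubSliver` / `…QuantTwoPointHubSliverOfU`: blob sum `W = Σ_k a_k ζ_k` with integer sizes `a k` and independent gates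
`p k`, tails `P(y ≤ W) = Σ_{s : y ≤ a(s)} ∏_k (p k if k ∈ s else 1 − p k)`.  The open blob lemma (U) of B4-SLIVER-G11 §8 reads
`y ≥ 3, 2y − 3 < EW, least gate g ≤ 1/2 ⟹ g ≤ P(y ≤ W)`.  This file proves the two tools of the reduction architecture of U-REDUCTIONS-G12 that
close (U) when at most ONE blob has its gate below `1/2`, and the terminal "half-world" row used by every reduction:

* `sum_weight_powerset_split` — conditioning the product weight on one coordinate (powerset form, no subtypes).
* `gate_raise` (the K3 raise) — for a blob `x₀` and `p x₀ ≤ θ ≤ 1`:  `p x₀ · P_{p[x₀ ↦ θ]}(y ≤ W) ≤ θ · P_p(y ≤ W)`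
  (the tail is affine in the gate `p x₀` with a nonnegative constant term, so `P/p x₀` is non-increasing in that gate).
* `tail_mono_gate` — the tail is non-decreasing in each gate; `tail_ge_tail_of_le_gates` — and in the whole gate vector.
* `half_le_tail_fair` — all gates `= 1/2` and `2y − 1 ≤ Σ a` ⟹ `1/2 ≤ P(y ≤ W)` (complement reflection);
  `half_le_tail_of_half_le_gates_of_size` — all gates `≥ 1/2` and `2y − 1 ≤ Σ a` ⟹ `1/2 ≤ P(y ≤ W)`.
* `half_le_tail_of_half_le_gates` (THEOREM A, the half-world row) — all gates `≥ 1/2`, sizes `≥ 1`, `y ≥ 3`, `2y − 3 < EW` ⟹ `1/2 ≤ P(y ≤ W)`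
  (`Σ a ≥ 2y − 1`: previous row; `Σ a = 2y − 2`: the closed mass has mean `< 1`, Markov `lowerTail_mul_le_closedMass`).
* `tail_ge_gate_of_others_ge_half` — **(U) when every blob other than the least reliable one has gate `≥ 1/2`**: raise `p y₀` to `1/2`
  by `gate_raise` and apply THEOREM A.
[this work]
-/

namespace Summit.CriticalPhenomena.PercolationContinuityZ3.Theorems

namespace Quant

namespace IndepBlob

open Finset

variable {κ : Type*} [Fintype κ] [DecidableEq κ]

omit [Fintype κ] in
/-- Conditioning the product weight of a finset `S ∋ k₀` on the coordinate `k₀` (powerset form):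
`Σ_{t ⊆ S} w_S(t) F(t) = q k₀ · Σ_{t ⊆ S∖k₀} w_{S∖k₀}(t) F(t ∪ {k₀}) + (1 − q k₀) · Σ_{t ⊆ S∖k₀} w_{S∖k₀}(t) F(t)`. [folklore] -/
theorem sum_weight_powerset_split (q : κ → ℝ) (S : Finset κ) {k₀ : κ} (hk₀ : k₀ ∈ S) (F : Finset κ → ℝ) :
    ∑ t ∈ S.powerset, (∏ k ∈ S, if k ∈ t then q k else 1 - q k) * F t =
      q k₀ * ∑ t ∈ (S.erase k₀).powerset, (∏ k ∈ S.erase k₀, if k ∈ t then q k else 1 - q k) * F (insert k₀ t) +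
        (1 - q k₀) * ∑ t ∈ (S.erase k₀).powerset, (∏ k ∈ S.erase k₀, if k ∈ t then q k else 1 - q k) * F t := by
  rw [← Finset.insert_erase hk₀, Finset.sum_powerset_insert (Finset.notMem_erase k₀ S), Finset.insert_erase hk₀,
    Finset.mul_sum, Finset.mul_sum, add_comm, ← Finset.sum_add_distrib, ← Finset.sum_add_distrib]
  have aux : ∀ t ∈ (S.erase k₀).powerset,
      (∏ k ∈ S, if k ∈ insert k₀ t then q k else 1 - q k) * F (insert k₀ t) +
        (∏ k ∈ S, if k ∈ t then q k else 1 - q k) * F t =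
      q k₀ * ((∏ k ∈ S.erase k₀, if k ∈ t then q k else 1 - q k) * F (insert k₀ t)) +
        (1 - q k₀) * ((∏ k ∈ S.erase k₀, if k ∈ t then q k else 1 - q k) * F t) := by
    intro t ht
    have hk₀t : k₀ ∉ t := fun h => Finset.notMem_erase k₀ S (Finset.mem_powerset.1 ht h)
    have h0 : (∏ k ∈ S, if k ∈ t then q k else 1 - q k) =
        (1 - q k₀) * ∏ k ∈ S.erase k₀, (if k ∈ t then q k else 1 - q k) := by
      rw [← Finset.mul_prod_erase S _ hk₀, if_neg hk₀t]
    have h1 : (∏ k ∈ S, if k ∈ insert k₀ t then q k else 1 - q k) =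
        q k₀ * ∏ k ∈ S.erase k₀, (if k ∈ t then q k else 1 - q k) := by
      rw [← Finset.mul_prod_erase S _ hk₀, if_pos (Finset.mem_insert_self _ _)]
      congr 1
      refine Finset.prod_congr rfl fun k hk => ?_
      have hne : k ≠ k₀ := (Finset.mem_erase.1 hk).1
      have : (k ∈ insert k₀ t) ↔ k ∈ t := by
        rw [Finset.mem_insert]
        exact ⟨fun h => h.resolve_left hne, Or.inr⟩
      simp only [this]
    rw [h0, h1]
    ring
  rw [Finset.sum_congr rfl aux, Finset.sum_add_distrib, ← Finset.mul_sum, ← Finset.mul_sum]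

/-- The tail `P(y ≤ W)` conditioned on one blob `x₀`: with `A = P'(y ≤ a x₀ + W')`, `B = P'(y ≤ W')` over the other blobs,
`P_p(y ≤ W) = p x₀ · A + (1 − p x₀) · B`, and `A, B` do not involve the gate `p x₀`. (Powerset form.) [folklore] -/
theorem tail_eq_gate_affine (p : κ → ℝ) (a : κ → ℕ) (x₀ : κ) (y : ℕ) :
    ∑ s ∈ (Finset.univ : Finset (Finset κ)).filter (fun s => y ≤ ∑ k ∈ s, a k), (∏ k, if k ∈ s then p k else 1 - p k) =
      p x₀ * ∑ t ∈ ((Finset.univ.erase x₀).powerset).filter (fun t => y ≤ a x₀ + ∑ k ∈ t, a k),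
          (∏ k ∈ Finset.univ.erase x₀, if k ∈ t then p k else 1 - p k) +
        (1 - p x₀) * ∑ t ∈ ((Finset.univ.erase x₀).powerset).filter (fun t => y ≤ ∑ k ∈ t, a k),
          (∏ k ∈ Finset.univ.erase x₀, if k ∈ t then p k else 1 - p k) := by
  have h := sum_weight_powerset_split p Finset.univ (Finset.mem_univ x₀)
    (fun s => if y ≤ ∑ k ∈ s, a k then (1 : ℝ) else 0)
  rw [Finset.powerset_univ] at h
  rw [Finset.sum_filter, Finset.sum_filter, Finset.sum_filter]
  have e1 : ∀ s : Finset κ, (if y ≤ ∑ k ∈ s, a k then (∏ k, if k ∈ s then p k else 1 - p k) else 0) =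
      (∏ k, if k ∈ s then p k else 1 - p k) * (if y ≤ ∑ k ∈ s, a k then (1 : ℝ) else 0) := fun s => by
    split_ifs <;> simp
  rw [Finset.sum_congr rfl fun s _ => e1 s, h]
  congr 1
  · congr 1
    refine Finset.sum_congr rfl fun t ht => ?_
    have hx : x₀ ∉ t := fun hh => Finset.notMem_erase x₀ _ (Finset.mem_powerset.1 ht hh)
    rw [Finset.sum_insert hx]
    split_ifs <;> simp
  · congr 1
    refine Finset.sum_congr rfl fun t _ => ?_
    split_ifs <;> simp

/-- Weights on the powerset of `univ ∖ x₀` are nonnegative when `0 ≤ p k ≤ 1`. [this work] -/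
theorem eraseWeight_nonneg {p : κ → ℝ} (hp0 : ∀ k, 0 ≤ p k) (hp1 : ∀ k, p k ≤ 1) (x₀ : κ) (t : Finset κ) :
    0 ≤ ∏ k ∈ Finset.univ.erase x₀, (if k ∈ t then p k else 1 - p k) := by
  refine Finset.prod_nonneg fun k _ => ?_
  split_ifs
  · exact hp0 k
  · linarith [hp1 k]

/-- **Raising one gate (the K3 raise).**  For gates `0 ≤ p k ≤ 1`, a blob `x₀` and `p x₀ ≤ θ ≤ 1`:
`p x₀ · P_{p[x₀ ↦ θ]}(y ≤ W) ≤ θ · P_p(y ≤ W)` — the tail divided by the gate of `x₀` is non-increasing in that gate, because the tail is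
`p x₀ · A + (1 − p x₀) · B` with `B ≥ 0`.  So a lower bound `θ ≤ P(y ≤ W)` AFTER raising the gate gives `p x₀ ≤ P(y ≤ W)` BEFORE. [this work] -/
theorem gate_raise (p : κ → ℝ) (a : κ → ℕ) (hp0 : ∀ k, 0 ≤ p k) (hp1 : ∀ k, p k ≤ 1) (x₀ : κ) (θ : ℝ)
    (hθ : p x₀ ≤ θ) (y : ℕ) :
    p x₀ * ∑ s ∈ (Finset.univ : Finset (Finset κ)).filter (fun s => y ≤ ∑ k ∈ s, a k),
        (∏ k, if k ∈ s then Function.update p x₀ θ k else 1 - Function.update p x₀ θ k) ≤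
      θ * ∑ s ∈ (Finset.univ : Finset (Finset κ)).filter (fun s => y ≤ ∑ k ∈ s, a k),
        (∏ k, if k ∈ s then p k else 1 - p k) := by
  rw [tail_eq_gate_affine (Function.update p x₀ θ) a x₀ y, tail_eq_gate_affine p a x₀ y, Function.update_self]
  -- the two conditional tails do not involve the gate of `x₀`
  have hw : ∀ t : Finset κ, (∏ k ∈ Finset.univ.erase x₀, if k ∈ t then Function.update p x₀ θ k else 1 - Function.update p x₀ θ k) =
      ∏ k ∈ Finset.univ.erase x₀, (if k ∈ t then p k else 1 - p k) := by
    intro t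
    refine Finset.prod_congr rfl fun k hk => ?_
    rw [Function.update_of_ne (Finset.mem_erase.1 hk).1]
  simp_rw [hw]
  set A : ℝ := ∑ t ∈ ((Finset.univ.erase x₀).powerset).filter (fun t => y ≤ a x₀ + ∑ k ∈ t, a k),
      (∏ k ∈ Finset.univ.erase x₀, if k ∈ t then p k else 1 - p k) with hA
  set B : ℝ := ∑ t ∈ ((Finset.univ.erase x₀).powerset).filter (fun t => y ≤ ∑ k ∈ t, a k),
      (∏ k ∈ Finset.univ.erase x₀, if k ∈ t then p k else 1 - p k) with hB
  have hB0 : 0 ≤ B := Finset.sum_nonneg fun t _ => eraseWeight_nonneg hp0 hp1 x₀ t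
  nlinarith [hB0, hθ, hp0 x₀]

/-- **The tail is non-decreasing in each gate.**  For `0 ≤ p k ≤ 1`, a blob `x₀` and `p x₀ ≤ θ`:
`P_p(y ≤ W) ≤ P_{p[x₀ ↦ θ]}(y ≤ W)` (the conditional tails satisfy `A ≥ B`). [folklore] -/
theorem tail_mono_gate (p : κ → ℝ) (a : κ → ℕ) (hp0 : ∀ k, 0 ≤ p k) (hp1 : ∀ k, p k ≤ 1) (x₀ : κ) (θ : ℝ)
    (hθ : p x₀ ≤ θ) (y : ℕ) :
    ∑ s ∈ (Finset.univ : Finset (Finset κ)).filter (fun s => y ≤ ∑ k ∈ s, a k), (∏ k, if k ∈ s then p k else 1 - p k) ≤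
      ∑ s ∈ (Finset.univ : Finset (Finset κ)).filter (fun s => y ≤ ∑ k ∈ s, a k),
        (∏ k, if k ∈ s then Function.update p x₀ θ k else 1 - Function.update p x₀ θ k) := by
  rw [tail_eq_gate_affine (Function.update p x₀ θ) a x₀ y, tail_eq_gate_affine p a x₀ y, Function.update_self]
  have hw : ∀ t : Finset κ, (∏ k ∈ Finset.univ.erase x₀, if k ∈ t then Function.update p x₀ θ k else 1 - Function.update p x₀ θ k) =
      ∏ k ∈ Finset.univ.erase x₀, (if k ∈ t then p k else 1 - p k) := by
    intro t
    refine Finset.prod_congr rfl fun k hk => ?_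
    rw [Function.update_of_ne (Finset.mem_erase.1 hk).1]
  simp_rw [hw]
  set A : ℝ := ∑ t ∈ ((Finset.univ.erase x₀).powerset).filter (fun t => y ≤ a x₀ + ∑ k ∈ t, a k),
      (∏ k ∈ Finset.univ.erase x₀, if k ∈ t then p k else 1 - p k) with hA
  set B : ℝ := ∑ t ∈ ((Finset.univ.erase x₀).powerset).filter (fun t => y ≤ ∑ k ∈ t, a k),
      (∏ k ∈ Finset.univ.erase x₀, if k ∈ t then p k else 1 - p k) with hB
  have hBA : B ≤ A := by
    refine Finset.sum_le_sum_of_subset_of_nonneg (fun t ht => ?_) fun t _ _ => eraseWeight_nonneg hp0 hp1 x₀ t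
    rw [Finset.mem_filter] at ht ⊢
    exact ⟨ht.1, ht.2.trans (Nat.le_add_left _ _)⟩
  nlinarith [hBA, hθ]

/-- **The tail is non-decreasing in the gate vector:** if `0 ≤ p k ≤ p' k ≤ 1` for every `k` then `P_p(y ≤ W) ≤ P_{p'}(y ≤ W)`.
(Change the gates one at a time, `tail_mono_gate`.) [folklore] -/
theorem tail_ge_tail_of_le_gates (p p' : κ → ℝ) (a : κ → ℕ) (hp0 : ∀ k, 0 ≤ p k) (hpp : ∀ k, p k ≤ p' k) (hp1 : ∀ k, p' k ≤ 1)
    (y : ℕ) :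
    ∑ s ∈ (Finset.univ : Finset (Finset κ)).filter (fun s => y ≤ ∑ k ∈ s, a k), (∏ k, if k ∈ s then p k else 1 - p k) ≤
      ∑ s ∈ (Finset.univ : Finset (Finset κ)).filter (fun s => y ≤ ∑ k ∈ s, a k), (∏ k, if k ∈ s then p' k else 1 - p' k) := by
  -- gates `p'` on `U`, `p` off `U`; induction on `U` from `∅` (all `p`) up to `univ` (all `p'`)
  suffices h : ∀ U : Finset κ,
      ∑ s ∈ (Finset.univ : Finset (Finset κ)).filter (fun s => y ≤ ∑ k ∈ s, a k), (∏ k, if k ∈ s then p k else 1 - p k) ≤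
        ∑ s ∈ (Finset.univ : Finset (Finset κ)).filter (fun s => y ≤ ∑ k ∈ s, a k),
          (∏ k, if k ∈ s then (if k ∈ U then p' k else p k) else 1 - (if k ∈ U then p' k else p k)) by
    have h0 := h Finset.univ
    simpa using h0
  intro U
  induction U using Finset.induction_on with
  | empty => simp
  | @insert k₀ U hk₀U ih =>
    have hmix0 : ∀ k, 0 ≤ (if k ∈ U then p' k else p k) := fun k => by
      split_ifs
      · exact (hp0 k).trans (hpp k)
      · exact hp0 k
    have hmix1 : ∀ k, (if k ∈ U then p' k else p k) ≤ 1 := fun k => by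
      split_ifs
      · exact hp1 k
      · exact (hpp k).trans (hp1 k)
    have hupd : (fun k => if k ∈ insert k₀ U then p' k else p k) =
        Function.update (fun k => if k ∈ U then p' k else p k) k₀ (p' k₀) := by
      funext k
      by_cases hk : k = k₀
      · subst hk
        simp
      · rw [Function.update_of_ne hk]
        simp [Finset.mem_insert, hk]
    have hle : (fun k => if k ∈ U then p' k else p k) k₀ ≤ p' k₀ := by
      show (if k₀ ∈ U then p' k₀ else p k₀) ≤ p' k₀
      rw [if_neg hk₀U]
      exact hpp k₀
    have step := tail_mono_gate (fun k => if k ∈ U then p' k else p k) a hmix0 hmix1 k₀ (p' k₀) hle y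
    rw [← hupd] at step
    exact ih.trans step

/-- **Fair coins: reflection.**  With every gate equal to `1/2` and total size `Σ a ≥ 2y − 1`, `1/2 ≤ P(y ≤ W)`: the complement map
`s ↦ sᶜ` sends `{a(s) ≤ y − 1}` injectively into `{y ≤ a(s)}` (`a(sᶜ) = Σ a − a(s) ≥ y`), and all configurations have the same weight. [folklore] -/
theorem half_le_tail_fair (a : κ → ℕ) (y : ℕ) (hT : 2 * y ≤ ∑ k, a k + 1) :
    (1 : ℝ) / 2 ≤ ∑ s ∈ (Finset.univ : Finset (Finset κ)).filter (fun s => y ≤ ∑ k ∈ s, a k),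
      (∏ k, if k ∈ s then (fun _ : κ => (1 : ℝ) / 2) k else 1 - (fun _ : κ => (1 : ℝ) / 2) k) := by
  set n : ℕ := Fintype.card κ with hn
  set H : Finset (Finset κ) := (Finset.univ : Finset (Finset κ)).filter (fun s => y ≤ ∑ k ∈ s, a k) with hH
  set L : Finset (Finset κ) := (Finset.univ : Finset (Finset κ)).filter (fun s => ¬ (y ≤ ∑ k ∈ s, a k)) with hL
  have hw : ∀ s : Finset κ, (∏ k, if k ∈ s then (fun _ : κ => (1 : ℝ) / 2) k else 1 - (fun _ : κ => (1 : ℝ) / 2) k) =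
      ((1 : ℝ) / 2) ^ n := by
    intro s
    rw [hn, ← Finset.card_univ, ← Finset.prod_const]
    refine Finset.prod_congr rfl fun k _ => ?_
    split_ifs <;> norm_num
  rw [Finset.sum_congr rfl fun s _ => hw s, Finset.sum_const, nsmul_eq_mul]
  -- `#L ≤ #H` by the complement injection
  have hLH : L.card ≤ H.card := by
    refine Finset.card_le_card_of_injOn (fun s => sᶜ) (fun s hs => ?_) (fun s _ t _ hst => compl_injective hst)
    rw [hL, Finset.mem_coe, Finset.mem_filter] at hs
    rw [hH, Finset.mem_coe, Finset.mem_filter]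
    refine ⟨Finset.mem_univ _, ?_⟩
    show y ≤ ∑ k ∈ sᶜ, a k
    have hsplit : ∑ k ∈ s, a k + ∑ k ∈ sᶜ, a k = ∑ k, a k := Finset.sum_add_sum_compl s a
    have hs2 : ¬ (y ≤ ∑ k ∈ s, a k) := hs.2
    omega
  have hsum : H.card + L.card = Fintype.card (Finset κ) := by
    rw [hH, hL, ← Finset.card_univ]
    exact Finset.card_filter_add_card_filter_not _
  rw [Fintype.card_finset, ← hn] at hsum
  have h2 : (2 : ℝ) ^ n ≤ 2 * (H.card : ℝ) := by
    have : (2 : ℕ) ^ n ≤ 2 * H.card := by omega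
    exact_mod_cast this
  have hpow : (2 : ℝ) ^ n * ((1 : ℝ) / 2) ^ n = 1 := by
    rw [← mul_pow]; norm_num
  have hpos : (0 : ℝ) < ((1 : ℝ) / 2) ^ n := by positivity
  nlinarith [h2, hpow, hpos]

/-- **All gates `≥ 1/2` and total size `≥ 2y − 1` give `1/2 ≤ P(y ≤ W)`** (fair-coin minorant `tail_ge_tail_of_le_gates` + reflection
`half_le_tail_fair`; no hypothesis on the mean). [this work] -/
theorem half_le_tail_of_half_le_gates_of_size (p : κ → ℝ) (a : κ → ℕ) (hp : ∀ k, (1 : ℝ) / 2 ≤ p k) (hp1 : ∀ k, p k ≤ 1)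
    (y : ℕ) (hT : 2 * y ≤ ∑ k, a k + 1) :
    (1 : ℝ) / 2 ≤ ∑ s ∈ (Finset.univ : Finset (Finset κ)).filter (fun s => y ≤ ∑ k ∈ s, a k), (∏ k, if k ∈ s then p k else 1 - p k) :=
  (half_le_tail_fair a y hT).trans
    (tail_ge_tail_of_le_gates (fun _ : κ => (1 : ℝ) / 2) p a (fun _ => by norm_num) hp hp1 y)

/-- **THEOREM A (the half-world row).**  Gates `1/2 ≤ p k ≤ 1`, integer sizes, a level `y ≥ 3` with `2y − 3 < EW = Σ a k · p k`.  Then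
`1/2 ≤ P(y ≤ W)`.  Proof: `Σ a ≥ EW > 2y − 3`; if `Σ a ≥ 2y − 1` use `half_le_tail_of_half_le_gates_of_size`; otherwise `Σ a = 2y − 2`, the
closed mass `Σ a − W` has mean `Σ a − EW < 1`, and Markov (`lowerTail_mul_le_closedMass`) gives `P(W ≤ y − 1)·(y − 1) < 1 ≤ (y − 1)/2`.
In particular (U) holds whenever the least gate is exactly `1/2`, for every `y ≥ 3` (B4-SLIVER-G11 §8 (iii) had `y ≥ 4`). [this work] -/
theorem half_le_tail_of_half_le_gates (p : κ → ℝ) (a : κ → ℕ) (hp : ∀ k, (1 : ℝ) / 2 ≤ p k) (hp1 : ∀ k, p k ≤ 1)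
    (y : ℕ) (hy : 3 ≤ y) (hEW : 2 * (y : ℝ) - 3 < ∑ k, (a k : ℝ) * p k) :
    (1 : ℝ) / 2 ≤ ∑ s ∈ (Finset.univ : Finset (Finset κ)).filter (fun s => y ≤ ∑ k ∈ s, a k), (∏ k, if k ∈ s then p k else 1 - p k) := by
  have hp0 : ∀ k, 0 ≤ p k := fun k => le_trans (by norm_num) (hp k)
  by_cases hT : 2 * y ≤ ∑ k, a k + 1
  · exact half_le_tail_of_half_le_gates_of_size p a hp hp1 y hT
  push Not at hT
  -- `Σ a = 2y − 2`
  have hTle : (∑ k, (a k : ℝ) * p k) ≤ ∑ k, (a k : ℝ) := by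
    refine Finset.sum_le_sum fun k _ => ?_
    have : (a k : ℝ) * p k ≤ (a k : ℝ) * 1 := mul_le_mul_of_nonneg_left (hp1 k) (by positivity)
    linarith
  have hTge : 2 * y ≤ ∑ k, a k + 2 := by
    have h1 : 2 * (y : ℝ) - 3 < ((∑ k, a k : ℕ) : ℝ) := by push_cast; linarith
    have h2 : ((2 * y : ℕ) : ℝ) < ((∑ k, a k + 3 : ℕ) : ℝ) := by push_cast; linarith
    have h3 : 2 * y < ∑ k, a k + 3 := by exact_mod_cast h2
    omega
  have hTeq : ∑ k, a k + 2 = 2 * y := by omega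
  have hTR : (∑ k, (a k : ℝ)) = 2 * (y : ℝ) - 2 := by
    have : ((∑ k, a k + 2 : ℕ) : ℝ) = ((2 * y : ℕ) : ℝ) := by exact_mod_cast hTeq
    push_cast at this
    linarith
  -- Markov for the closed mass at `j = y − 1`
  have hM := lowerTail_mul_le_closedMass p a hp0 hp1 ((y : ℝ) - 1)
  have hclosed : ∑ k, (a k : ℝ) * (1 - p k) = (∑ k, (a k : ℝ)) - ∑ k, (a k : ℝ) * p k := by
    rw [← Finset.sum_sub_distrib]
    exact Finset.sum_congr rfl fun k _ => by ring
  rw [hclosed, hTR] at hM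
  -- identify the lower tail with the complement of the tail event
  have hL : ∑ s ∈ (Finset.univ : Finset (Finset κ)).filter (fun s => ∑ k ∈ s, (a k : ℝ) ≤ (y : ℝ) - 1),
      (∏ k, if k ∈ s then p k else 1 - p k) =
      ∑ s ∈ (Finset.univ : Finset (Finset κ)).filter (fun s => ¬ (y ≤ ∑ k ∈ s, a k)), (∏ k, if k ∈ s then p k else 1 - p k) := by
    refine Finset.sum_congr (Finset.filter_congr fun s _ => ?_) fun _ _ => rfl
    rw [not_le]
    constructor
    · intro h
      have h' : ((∑ k ∈ s, a k : ℕ) : ℝ) ≤ (y : ℝ) - 1 := by push_cast; exact h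
      have : ((∑ k ∈ s, a k : ℕ) : ℝ) < ((y : ℕ) : ℝ) := by linarith
      exact_mod_cast this
    · intro h
      have h1 : ∑ k ∈ s, a k + 1 ≤ y := h
      have : ((∑ k ∈ s, a k + 1 : ℕ) : ℝ) ≤ ((y : ℕ) : ℝ) := by exact_mod_cast h1
      push_cast at this ⊢
      linarith
  have hcompl := Finset.sum_filter_add_sum_filter_not (Finset.univ : Finset (Finset κ))
    (fun s => y ≤ ∑ k ∈ s, a k) (fun s => (∏ k, if k ∈ s then p k else 1 - p k))
  rw [sum_bernoulliWeight p] at hcompl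
  rw [hL] at hM
  have hy' : (3 : ℝ) ≤ (y : ℝ) := by exact_mod_cast hy
  set Lw : ℝ := ∑ s ∈ (Finset.univ : Finset (Finset κ)).filter (fun s => ¬ (y ≤ ∑ k ∈ s, a k)),
      (∏ k, if k ∈ s then p k else 1 - p k) with hLw
  -- `Lw · (y − 1) < 1` and `y − 1 ≥ 2`
  have hM' : Lw * ((y : ℝ) - 1) < 1 := by
    have : 2 * (y : ℝ) - 2 - ((y : ℝ) - 1) = (y : ℝ) - 1 := by ring
    rw [this] at hM
    linarith
  nlinarith [hM', hy', hcompl]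

/-- **(U) when every blob other than the least reliable one has gate `≥ 1/2`.**  Gates `0 ≤ p k ≤ 1`, integer sizes, a blob `y₀` with
`p y₀ ≤ 1/2` and `1/2 ≤ p k` for every `k ≠ y₀`, a level `y ≥ 3` with `2y − 3 < EW`.  Then `p y₀ ≤ P(y ≤ W)`: raise the gate of `y₀`
to `1/2` (`gate_raise`; the mean only increases) and apply the half-world row `half_le_tail_of_half_le_gates`.  This is the hypothesis
`hU` of `twoPointHub_sliver_of_U` for configurations with a single sub-half gate (B4-SLIVER-G11 §8 (v) 'K3 raise', made unconditional). [this work] -/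
theorem tail_ge_gate_of_others_ge_half (p : κ → ℝ) (a : κ → ℕ) (hp0 : ∀ k, 0 ≤ p k) (hp1 : ∀ k, p k ≤ 1)
    (y₀ : κ) (hhalf : p y₀ ≤ 1 / 2) (hothers : ∀ k, k ≠ y₀ → (1 : ℝ) / 2 ≤ p k)
    (y : ℕ) (hy : 3 ≤ y) (hEW : 2 * (y : ℝ) - 3 < ∑ k, (a k : ℝ) * p k) :
    p y₀ ≤ ∑ s ∈ (Finset.univ : Finset (Finset κ)).filter (fun s => y ≤ ∑ k ∈ s, a k), (∏ k, if k ∈ s then p k else 1 - p k) := by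
  set p' : κ → ℝ := Function.update p y₀ (1 / 2) with hp'
  have hp'half : ∀ k, (1 : ℝ) / 2 ≤ p' k := by
    intro k
    by_cases hk : k = y₀
    · subst hk; rw [hp', Function.update_self]
    · rw [hp', Function.update_of_ne hk]; exact hothers k hk
  have hp'1 : ∀ k, p' k ≤ 1 := by
    intro k
    by_cases hk : k = y₀
    · subst hk; rw [hp', Function.update_self]; norm_num
    · rw [hp', Function.update_of_ne hk]; exact hp1 k
  have hpp' : ∀ k, p k ≤ p' k := by
    intro k
    by_cases hk : k = y₀
    · subst hk; rw [hp', Function.update_self]; exact hhalf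
    · rw [hp', Function.update_of_ne hk]
  have hEW' : 2 * (y : ℝ) - 3 < ∑ k, (a k : ℝ) * p' k := by
    refine lt_of_lt_of_le hEW (Finset.sum_le_sum fun k _ => ?_)
    exact mul_le_mul_of_nonneg_left (hpp' k) (by positivity)
  have hA := half_le_tail_of_half_le_gates p' a hp'half hp'1 y hy hEW'
  have hK := gate_raise p a hp0 hp1 y₀ (1 / 2) hhalf y
  rw [← hp'] at hK
  nlinarith [hA, hK, hp0 y₀]


end IndepBlob

end Quant

end Summit.CriticalPhenomena.PercolationContinuityZ3.Theorems
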